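import Summits.ValiantsHypothesis.ValiantsHypothesis.Theorems.DegreeDialDesignTensor
import Summits.ValiantsHypothesis.ValiantsHypothesis.Theorems.OrderedCountWindowBalancing
import HarnessLib

/-!
# DegreeDial rung R1: the Reed–Solomon design tensor at degree `d = ⌊log₂ n⌋` is not a sum of
# polylogarithmically many ordered set-multilinear ABPs of polynomial total width

The DEGREE DIAL (workshop lens 6, generation 9) reads Valiant's hypothesis through the design family
`NW_{m+1, d, d/2}` (`Literature…NWDesignPolynomialVNP.nwDesign`, in `VNP`) at `d = ⌊log₂(m+1)⌋` blocks of
`m+1` letters: `VP = VNP` would put the family in `VP`, an ORDERED COLLAPSE of low-degree circuits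
(open) would make its block-coefficient tensor a sum of ordered set-multilinear ABPs (`IsSumOrderedT`)
of total width `(m+2)^{O(1)}`, and the crux `DesignBeyondBalancing` says that this tensor is no such
sum, for ANY number `t` of summands.  This file proves the first rung of that crux: the statement for
`t ≤ d^a` summands, every `a` (`designBeyondBalancing_polylogSupport`).  The balancing engine of
`OrderedCountWindowBalancing` reaches exactly the supports `t < 2^d/(d+1)`; beyond that the crux is
open.  (Chatterjee–Kush–Saraf–Shpilka prove the bound for every `t` when `d = ω(log n)`, taking the
union bound over the width; at `d = Θ(log n)` that union bound only gives polynomial width, and the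
rung takes it over the `t` summands instead.)

§4 the reservoir inequality with alphabet `m+1` (`pow_le_pow_of_isSumOrderedT_design`: balance all
`t` orders at once by `balancedSegments`, bound each summand's flattening by the segment-rank lemma,
compare with the full rank `(m+1)^P` of `rank_setFlattening_designTensor`); §5 the parameter choice
(`r = (1024(c+1))²`, a Bertrand prime in `(2^d, 2^{d+1}]`).

References: P. Chatterjee, D. Kush, S. Saraf, A. Shpilka, *Lower bounds for set-multilinear branching
programs*, CCC 2024 (LIPIcs 300, 20), Thm 1.4, §1.5, Def 3.2, Claim 3.3
[cite: ChatterjeeKushSarafShpilka2024]; N. Kayal, C. Saha, R. Saptharishi, STOC 2014, §1 (the design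
polynomial) [cite: KayalSahaSaptharishi2014, §1].
-/

set_option linter.dupNamespace false

noncomputable section

namespace Summit.ValiantsHypothesis.ValiantsHypothesis.Theorems.DegreeDial

open Literature.Computability.AlgebraicComplexity Matrix
open Summit.ValiantsHypothesis.ValiantsHypothesis.Theorems.OrderedCountWindow


/-! ## §4 The base-`(m+1)` reservoir inequality for the design tensor -/

/-- **Reservoir inequality, alphabet `m+1`**: if the design tensor of `NW_{m+1,2P,P}` (`2P = q·r`
blocks, `r ≥ 1024`) is a sum of `t` ordered set-multilinear ABPs of total width `≤ W` with FEW
summands (`t·(2P+1) < 2^q`), then `(m+1)^{q⌊√r/32⌋/4} ≤ W^{q+1}`: balance all `t` orders at once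
(`balancedSegments`), bound each summand's flattening by the segment-rank lemma, and compare with the
full rank `(m+1)^P` of the design tensor's flattening.
[cite: ChatterjeeKushSarafShpilka2024, Thm 1.4 and §1.5 (generalization of Nisan's argument), with
Claim 3.3 — here with the union bound over the summands instead of over the width] -/
theorem pow_le_pow_of_isSumOrderedT_design {m P q r t W : ℕ} (hp : (m + 1).Prime)
    (hd : P + P ≤ m + 1) (hN : P + P = q * r) (hr : 1024 ≤ r) (ht : t * (P + P + 1) < 2 ^ q)
    (h : IsSumOrderedT t W fun j : Fin (P + P) → Fin (m + 1) =>
      MvPolynomial.coeff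
        (∑ i : Fin (P + P),
          Finsupp.single (⟨i, (j i : ZMod (m + 1))⟩ : Σ _ : Fin (P + P), ZMod (m + 1)) 1)
        (nwDesign (m + 1) (P + P) P)) :
    (m + 1) ^ (q * (Nat.sqrt r / 32) / 4) ≤ W ^ (q + 1) := by
  classical
  set T : (Fin (P + P) → Fin (m + 1)) → ℂ := fun j : Fin (P + P) → Fin (m + 1) =>
      MvPolynomial.coeff
        (∑ i : Fin (P + P),
          Finsupp.single (⟨i, (j i : ZMod (m + 1))⟩ : Σ _ : Fin (P + P), ZMod (m + 1)) 1)
        (nwDesign (m + 1) (P + P) P) with hTdef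
  obtain ⟨σ, w, B', hσ, hB', hsum, hT⟩ := normalForm h
  have hwW : ∀ i, w i ≤ W := fun i =>
    (Finset.single_le_sum (fun i _ => Nat.zero_le (w i)) (Finset.mem_univ i)).trans hsum
  have hι' : Fintype.card (Fin t) * (P + P + 1) < 2 ^ q := by simpa using ht
  -- the segments of all `t` orders, balanced by `balancedSegments`
  let τ : Fin t → Fin (q * r) → Fin (P + P) := fun i p => σ i (Fin.cast hN.symm p)
  have hτ : ∀ i, Function.Injective (τ i) := fun i =>
    (hσ i).1.comp (Fin.cast_injective _)
  let A : Fin t → Fin q → Finset (Fin (P + P)) := fun i b => segment (τ i) b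
  obtain ⟨S, hS, himb⟩ := balancedSegments (Fin t) P q r A hr hι'
    (fun i b => card_segment (hτ i) b) (fun i b b' hbb' => disjoint_segment (hτ i) hbb')
  -- the full-rank flattening of the design tensor across `S`
  have hD : (setFlattening S T).rank = (m + 1) ^ P := by
    rw [hTdef]
    exact rank_setFlattening_designTensor hp hd S hS
  have hflat : setFlattening S T = ∑ i, setFlattening S (B' i) := by
    rw [← setFlattening_sum]
    congr 1
    funext j
    exact (hT j).symm
  -- per-program bound
  set hh := q * (Nat.sqrt r / 32) / 4 with hhh
  have hm1 : 0 < m + 1 := Nat.succ_pos m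
  have hprog : ∀ i, (setFlattening S (B' i)).rank * (m + 1) ^ hh ≤ w i ^ (q + 1) * (m + 1) ^ P := by
    intro i
    have hprog' := rank_setFlattening_le_of_hasOsmWidthLE (n := m + 1) (τ i)
      (HasOsmWidthLE.castLayers hN (hB' i)) S
    have hbook : ∑ b : Fin q, min (segment (τ i) b ∩ S).card (segment (τ i) b \ S).card + hh
        ≤ P := by
      refine sum_min_add_le S (fun b => segment (τ i) b) ?_ (himb i)
      rw [Finset.sum_congr rfl fun b _ => card_segment (hτ i) b]
      simp [hN]
    calc (setFlattening S (B' i)).rank * (m + 1) ^ hh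
        ≤ (w i ^ (q + 1) * (m + 1) ^ ∑ b : Fin q, min (segment (τ i) b ∩ S).card
            (segment (τ i) b \ S).card) * (m + 1) ^ hh := Nat.mul_le_mul_right _ hprog'
      _ = w i ^ (q + 1) * (m + 1) ^ (∑ b : Fin q, min (segment (τ i) b ∩ S).card
            (segment (τ i) b \ S).card + hh) := by rw [mul_assoc, ← pow_add]
      _ ≤ w i ^ (q + 1) * (m + 1) ^ P :=
          Nat.mul_le_mul_left _ (Nat.pow_le_pow_right hm1 hbook)
  -- sum up
  have hmain : (m + 1) ^ P * (m + 1) ^ hh ≤ (∑ i, w i ^ (q + 1)) * (m + 1) ^ P := by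
    calc (m + 1) ^ P * (m + 1) ^ hh
        = (setFlattening S T).rank * (m + 1) ^ hh := by rw [hD]
      _ ≤ (∑ i, (setFlattening S (B' i)).rank) * (m + 1) ^ hh := by
            rw [hflat]
            exact Nat.mul_le_mul_right _ (rank_sum_le _ _)
      _ = ∑ i, (setFlattening S (B' i)).rank * (m + 1) ^ hh := Finset.sum_mul _ _ _
      _ ≤ ∑ i, w i ^ (q + 1) * (m + 1) ^ P := Finset.sum_le_sum fun i _ => hprog i
      _ = (∑ i, w i ^ (q + 1)) * (m + 1) ^ P := (Finset.sum_mul _ _ _).symm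
  have hsumpow : ∑ i, w i ^ (q + 1) ≤ W ^ (q + 1) := by
    calc ∑ i, w i ^ (q + 1) = ∑ i, w i * w i ^ q := Finset.sum_congr rfl fun i _ => by ring
      _ ≤ ∑ i, w i * W ^ q := Finset.sum_le_sum fun i _ =>
          Nat.mul_le_mul_left _ (Nat.pow_le_pow_left (hwW i) q)
      _ = (∑ i, w i) * W ^ q := (Finset.sum_mul _ _ _).symm
      _ ≤ W * W ^ q := Nat.mul_le_mul_right _ hsum
      _ = W ^ (q + 1) := by ring
  have h2 : (m + 1) ^ hh ≤ ∑ i, w i ^ (q + 1) := by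
    rw [mul_comm] at hmain
    exact Nat.le_of_mul_le_mul_right hmain (by positivity)
  exact h2.trans hsumpow

/-! ## §5 Parameters: the rung `DesignBeyondBalancing` for polylogarithmic support -/

/-- Linear functions are eventually below `2^u`. -/
theorem lin_base_lt_two_pow (L : ℕ) : L * (2 * L + 2) + 1 < 2 ^ (2 * L + 2) := by
  induction L with
  | zero => norm_num
  | succ L ih =>
    rw [show 2 * (L + 1) + 2 = (2 * L + 2) + 2 by ring, pow_add]
    have h4 : (4 : ℕ) ≤ 2 ^ (2 * L + 2) := by
      calc (4 : ℕ) = 2 ^ 2 := by norm_num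
        _ ≤ 2 ^ (2 * L + 2) := Nat.pow_le_pow_right (by norm_num) (by omega)
    rcases Nat.eq_zero_or_pos L with h0 | hpos
    · subst h0; norm_num
    · nlinarith [ih, h4]

/-- `L·u + 1 < 2^u` for `u ≥ 2L + 2`. -/
theorem lin_lt_two_pow (L : ℕ) {u : ℕ} (hu : 2 * L + 2 ≤ u) : L * u + 1 < 2 ^ u := by
  induction u, hu using Nat.le_induction with
  | base => exact lin_base_lt_two_pow L
  | succ u hu ih =>
    have hL : L ≤ 2 ^ u := (show L ≤ u by omega).trans (Nat.lt_two_pow_self).le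
    rw [pow_succ]
    nlinarith [ih, hL]

/-- **Rung R1 of `DesignBeyondBalancing` (lens-6 g9): for every width exponent `c`, support exponent `a`
and threshold `m₀` there is a prime `m+1 > m₀` such that the block-coefficient tensor of the
Reed–Solomon design polynomial `NW_{m+1, d, d/2}` with `d = ⌊log₂(m+1)⌋` is NOT a sum of
`t ≤ d^a` ordered set-multilinear ABPs of total width `(m+2)^c`.**  (The crux `DesignBeyondBalancing`
of the DegreeDial node is the same statement for EVERY `t`; the balancing engine reaches exactly the
supports `t < 2^d/(d+1)`, and polylogarithmic support is the first rung.)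
[cite: ChatterjeeKushSarafShpilka2024, Thm 1.4 (the method, there for `d = ω(log n)` and any number
of summands), Def 3.2 / Claim 3.3 (the design polynomial); KayalSahaSaptharishi2014, §1] -/
theorem designBeyondBalancing_polylogSupport (a c m₀ : ℕ) :
    ∃ m : ℕ, m₀ ≤ m ∧ ∀ t : ℕ, t ≤ Nat.log 2 (m + 1) ^ a →
      ¬ IsSumOrderedT (F := ℂ) t ((m + 2) ^ c)
        (fun j : Fin (Nat.log 2 (m + 1)) → Fin (m + 1) =>
          MvPolynomial.coeff
            (∑ i : Fin (Nat.log 2 (m + 1)),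
              Finsupp.single (⟨i, (j i : ZMod (m + 1))⟩ : Σ _ : Fin (Nat.log 2 (m + 1)), ZMod (m + 1)) 1)
            (nwDesign (m + 1) (Nat.log 2 (m + 1)) (Nat.log 2 (m + 1) / 2))) := by
  classical
  -- constants
  obtain ⟨r, hr_def⟩ : ∃ r : ℕ, r = (1024 * (c + 1)) ^ 2 := ⟨_, rfl⟩
  obtain ⟨L, hL_def⟩ : ∃ L : ℕ, L = (a + 1) * r := ⟨_, rfl⟩
  obtain ⟨u, hu_def⟩ : ∃ u : ℕ, u = 2 * L + 2 + (m₀ + 1) := ⟨_, rfl⟩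
  obtain ⟨q, hq_def⟩ : ∃ q : ℕ, q = (a + 1) * u := ⟨_, rfl⟩
  obtain ⟨P, hP_def⟩ : ∃ P : ℕ, P = q * (524288 * (c + 1) ^ 2) := ⟨_, rfl⟩
  have hN : P + P = q * r := by rw [hP_def, hr_def]; ring
  have hr : 1024 ≤ r := by
    rw [hr_def, pow_two]
    calc (1024 : ℕ) = 1024 * 1 := by norm_num
      _ ≤ 1024 * (c + 1) * (1024 * (c + 1)) := by nlinarith
  have hq1 : 1 ≤ q := by rw [hq_def, hu_def]; nlinarith
  have hdpos : 1 ≤ P + P := by rw [hN]; nlinarith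
  -- `d + 1 < 2^u`, hence few summands: `(d+1)^{a+1} < 2^q`
  have hdu : P + P + 1 < 2 ^ u := by
    rw [hN, hq_def, show (a + 1) * u * r = L * u by rw [hL_def]; ring]
    exact lin_lt_two_pow L (by omega)
  have hfew : (P + P + 1) ^ (a + 1) < 2 ^ q := by
    rw [hq_def, mul_comm (a + 1) u, pow_mul]
    exact Nat.pow_lt_pow_left hdu (by omega)
  -- a prime `m + 1 ∈ (2^d, 2^{d+1})`
  obtain ⟨p, hp, hlt, hle⟩ := Nat.exists_prime_lt_and_le_two_mul (2 ^ (P + P)) (by positivity)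
  obtain ⟨m, rfl⟩ := Nat.exists_eq_succ_of_ne_zero hp.ne_zero
  rw [Nat.succ_eq_add_one] at hp hlt hle
  have hlt2 : m + 1 < 2 ^ (P + P + 1) := by
    rcases lt_or_eq_of_le hle with h | h
    · rw [pow_succ]; omega
    · exfalso
      have h2 : 2 ∣ m + 1 := ⟨2 ^ (P + P), by rw [h]⟩
      rcases (Nat.Prime.eq_one_or_self_of_dvd hp 2 h2) with h' | h'
      · norm_num at h'
      · have : 2 ^ (P + P) = 1 := by omega
        rw [Nat.pow_eq_one] at this
        omega
  have hlog : Nat.log 2 (m + 1) = P + P := Nat.log_eq_of_pow_le_of_lt_pow hlt.le hlt2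
  have hdm : P + P ≤ m + 1 := ((Nat.lt_two_pow_self).le.trans hlt.le)
  have hm₀ : m₀ ≤ m := by
    have h1 : m₀ + 1 ≤ P + P := by rw [hN, hq_def, hu_def]; nlinarith
    have h2 : P + P < 2 ^ (P + P) := Nat.lt_two_pow_self
    omega
  refine ⟨m, hm₀, fun t ht h' => ?_⟩
  -- rewrite `d = ⌊log₂(m+1)⌋ = P + P` and `d / 2 = P` in the statement's tensor
  rw [hlog, show (P + P) / 2 = P by omega] at h'
  rw [hlog] at ht
  have ht' : t * (P + P + 1) < 2 ^ q := by
    calc t * (P + P + 1) ≤ (P + P) ^ a * (P + P + 1) := Nat.mul_le_mul_right _ ht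
      _ ≤ (P + P + 1) ^ a * (P + P + 1) :=
          Nat.mul_le_mul_right _ (Nat.pow_le_pow_left (Nat.le_succ _) a)
      _ = (P + P + 1) ^ (a + 1) := by ring
      _ < 2 ^ q := hfew
  have hmain := pow_le_pow_of_isSumOrderedT_design hp hdm hN hr ht' h'
  -- evaluate the exponent: `⌊√r⌋ = 1024(c+1)`, `q · 32(c+1) / 4 = 8q(c+1)`
  have hsqrt : Nat.sqrt r = 1024 * (c + 1) := by rw [hr_def, Nat.sqrt_eq']
  have hexp : q * (Nat.sqrt r / 32) / 4 = 8 * q * (c + 1) := by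
    rw [hsqrt, show 1024 * (c + 1) = 32 * (32 * (c + 1)) by ring,
      Nat.mul_div_cancel_left _ (by norm_num : 0 < 32),
      show q * (32 * (c + 1)) = 4 * (8 * q * (c + 1)) by ring,
      Nat.mul_div_cancel_left _ (by norm_num : 0 < 4)]
  rw [hexp] at hmain
  -- `(m+2)^c ≤ (m+1)^{2c}` and `2c(q+1) < 8q(c+1)` contradict `hmain`
  have hm1 : 1 ≤ m := by
    have : 2 ≤ 2 ^ (P + P) := by
      calc (2 : ℕ) = 2 ^ 1 := by norm_num
        _ ≤ 2 ^ (P + P) := Nat.pow_le_pow_right (by norm_num) hdpos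
    omega
  have hW : (m + 2) ^ c ≤ (m + 1) ^ (2 * c) := by
    rw [pow_mul]
    exact Nat.pow_le_pow_left (by nlinarith) c
  have hlt3 : ((m + 2) ^ c) ^ (q + 1) < (m + 1) ^ (8 * q * (c + 1)) := by
    calc ((m + 2) ^ c) ^ (q + 1) ≤ ((m + 1) ^ (2 * c)) ^ (q + 1) := Nat.pow_le_pow_left hW _
      _ = (m + 1) ^ (2 * c * (q + 1)) := by rw [← pow_mul]
      _ < (m + 1) ^ (8 * q * (c + 1)) := Nat.pow_lt_pow_right (by omega) (by nlinarith)
  exact absurd (hmain.trans_lt hlt3) (lt_irrefl _)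

end Summit.ValiantsHypothesis.ValiantsHypothesis.Theorems.DegreeDial

end
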